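import Summits.QuantumFields.YangMills.Theorems.LuscherReductionTwistedTraceScalingSliceTaylor
import Summits.QuantumFields.YangMills.Theorems.LuscherReductionTwistedTraceScalingSliceMeets
import Summits.QuantumFields.YangMills.Theorems.LuscherReductionTwistedTraceScalingSliceFormBased
import HarnessLib

/-!
# The Laplace data in BASED gauge coordinates: exact linear map at every base point, uniform second-order remainder, uniform coercivity
# (lane A of S-BASE, crux `TwistedTraceScaling` stmt-QuantumFields-20203, C4 INNER; design note `pub/ym-fleet/ym-luscher-20007-p1/COARSE-DESIGN.md` §23.9 (N2))

The Faddeev–Popov weight is a based average (`…GaugeAverageBased`): the gauge parameter `ξ` has `ξ(0) = 0`.  THIS FILE assembles, for the restricted map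
`fB : (ξ, (w, c)) ↦ relLinkVec((orthoTube P(c) w)^{P∘ξ})` on `{ξ(0)=0} × (balanced w × c)`, everything the Laplace sandwich (`…LaplaceSandwich`) consumes:
* ★ `hasFDerivAt_basedFn` / `fderiv_basedFn_zero`: the derivative at `0` is `(ξ', w', c') ↦ w' − ∇ξ'` (quadratic remainder `norm_basedFn_sub_basedDeriv_le` from `…GaugeActionBased`,
  uniqueness against the strict derivative of `…SliceSmooth`);
* ★★ `exists_taylor_two_basedFn`: `‖fB(ξ,p) − fB(0,p) − basedLin p ξ‖ ≤ M‖ξ‖²` uniformly for small `(ξ, p)`, with the EXACT linear map `basedLin p = ∂_ξ fB(0,p)` (`…SliceTaylor`);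
* `basedLin_zero`: `basedLin 0 ξ = −∇ξ`; ★ `norm_le_basedLin_zero`: `‖ξ‖∞ ≤ 2C_L·‖P_Γ(basedLin 0 ξ)‖` (coercivity at the vacuum base point, `…SliceFormBased`);
  `continuousAt_basedLin` (the linear map depends continuously on the base point; the quantitative version is the sequel `…SliceCoerciveBased`).
So at a slice point `U* = orthoTube P(c*) w*` (`P_Γ w* = 0`): `P_Γ relLinkVec(U*^{P∘ξ}) = P_Γ basedLin(w*,c*) ξ + O(M‖ξ‖²)` — the core hypothesis of `laplace_sandwich` with
`A = P_Γ ∘ basedLin(w*,c*)`, `η = O(M·C_L·r)`.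
HONEST FRAMING: finite-dimensional calculus for a stub of a child of the CONDITIONAL reduction route R2b1; no spectral claim; C4 OPEN; not a gap, not Clay.
-/

set_option autoImplicit false

noncomputable section

open Filter Topology Real Asymptotics Metric
open scoped BigOperators
open Literature.MathematicalPhysics.QuantumFieldTheory
open Literature.MathematicalPhysics.QuantumLattice

namespace Summit.QuantumFields.YangMills.Theorems.FemtoTransferGap.TwoLattice.ConstTube

open Summit.QuantumFields.YangMills.Theorems.FemtoTransferGap
open Summit.QuantumFields.YangMills.Theorems.FemtoTransferGap.TwoLattice.Stiff (LinkSpace)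
open Literature.Algebra.EuclideanLattices (abs_apply_le_norm)

variable (L : ℕ) [NeZero L]

/-! ## §1 Based gauge parameters and the restricted map -/

/-- The based gauge parameters `{ξ | ξ 0 = 0}`. [folklore] -/
def basedSubmodule : Submodule ℝ (Site 3 L → Fin 3 → ℝ) where
  carrier := {ξ | ξ 0 = 0}
  add_mem' {a b} ha hb := by simp only [Set.mem_setOf_eq, Pi.add_apply] at *; rw [ha, hb, add_zero]
  zero_mem' := rfl
  smul_mem' r a ha := by simp only [Set.mem_setOf_eq, Pi.smul_apply] at *; rw [ha, smul_zero]

/-- The based domain: (based `ξ`) × ((balanced `w`) × (slow coordinate `c`)). [folklore] -/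
abbrev BasedDom : Type := basedSubmodule L × (balancedSubmodule L × (Fin 3 → Fin 3 → ℝ))

/-- Its inclusion into the parameter space. [folklore] -/
def basedIncl : BasedDom L →L[ℝ] SliceParam L :=
  (basedSubmodule L).subtypeL.prodMap ((balancedSubmodule L).subtypeL.prodMap (ContinuousLinearMap.id ℝ (Fin 3 → Fin 3 → ℝ)))

/-- Components of the inclusion. [folklore] -/
@[simp] theorem basedIncl_apply (h : BasedDom L) : basedIncl L h = ((h.1 : Site 3 L → Fin 3 → ℝ), ((h.2.1 : Edge 3 L → Fin 3 → ℝ), h.2.2)) := rfl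

/-- The restricted map `fB = Φ̂ ∘ ι_B`. [folklore] -/
def basedFn (h : BasedDom L) : LinkSpace L := relLinkVec L (actCfg L (basedIncl L h))

/-- The candidate derivative at `0`: `(ξ', (w', c')) ↦ w' − ∇ξ'`. [folklore] -/
def basedDeriv : BasedDom L →L[ℝ] LinkSpace L :=
  (LinearMap.toContinuousLinearMap (linkEmbed L ∘ₗ (balancedSubmodule L).subtype)).comp
      ((ContinuousLinearMap.fst ℝ _ _).comp (ContinuousLinearMap.snd ℝ (basedSubmodule L) _)) -
    (LinearMap.toContinuousLinearMap (vacGrad L ∘ₗ (basedSubmodule L).subtype)).comp (ContinuousLinearMap.fst ℝ (basedSubmodule L) _)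

/-- Components of the candidate derivative. [folklore] -/
theorem basedDeriv_apply (h : BasedDom L) : basedDeriv L h = linkEmbed L (h.2.1 : Edge 3 L → Fin 3 → ℝ) - vacGrad L (h.1 : Site 3 L → Fin 3 → ℝ) := rfl

/-- `∇(ξ − ξ̄) = ∇ξ`. [folklore] -/
theorem vacGrad_sub_siteMean (ξ : Site 3 L → Fin 3 → ℝ) : vacGrad L (fun x => ξ x - siteMean L ξ) = vacGrad L ξ := by
  have h : (fun x => ξ x - siteMean L ξ) = ξ - fun _ => siteMean L ξ := rfl
  rw [h, map_sub, vacGrad_const, sub_zero]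

/-! ## §2 The derivative at `0` -/

/-- ★ **Quadratic remainder at `0`**: for `‖h‖ ≤ 1/40`, `‖fB h − (w − ∇ξ)‖ ≤ 2796·√(3|E|)·‖h‖²`. [folklore] -/
theorem norm_basedFn_sub_basedDeriv_le (h : BasedDom L) (hh : ‖h‖ ≤ 1 / 40) :
    ‖basedFn L h - basedDeriv L h‖ ≤ 2796 * Real.sqrt (3 * Fintype.card (Edge 3 L)) * ‖h‖ ^ 2 := by
  set ξ : Site 3 L → Fin 3 → ℝ := (h.1 : Site 3 L → Fin 3 → ℝ) with hξdef
  set w : Edge 3 L → Fin 3 → ℝ := (h.2.1 : Edge 3 L → Fin 3 → ℝ) with hwdef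
  set c : Fin 3 → Fin 3 → ℝ := h.2.2 with hcdef
  set u : GaugeConfig 3 1 SU2 := fun e₁ => chartSU2 (c e₁.2) with hudef
  have hξn : ‖ξ‖ ≤ ‖h‖ := norm_fst_le h
  have hwn : ‖w‖ ≤ ‖h‖ := (norm_fst_le h.2).trans (norm_snd_le h)
  have hcn : ‖c‖ ≤ ‖h‖ := (norm_snd_le h.2).trans (norm_snd_le h)
  have h0 : 0 ≤ ‖h‖ := norm_nonneg h
  have hG : ∀ x, ‖ξ x‖ ≤ ‖h‖ := fun x => (norm_le_pi_norm ξ x).trans hξn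
  have hω : ∀ e, ‖w e‖ ≤ ‖h‖ := fun e => (norm_le_pi_norm w e).trans hwn
  have hbal : ∀ (k : Fin 3) (a : Fin 3), ∑ x : Site 3 L, w (x, k) a = 0 := h.2.1.2
  have hcτ : ∀ (k : Fin 3) (b : Fin 3), |vecPart (u (0, k)) b| ≤ ‖h‖ := fun k b => by
    have hc1 : ∑ a, c k a ^ 2 ≤ 1 := by
      have h3 := sum_sq_le_three_norm_sq (c k)
      have hck : ‖c k‖ ≤ 1 / 40 := ((norm_le_pi_norm c k).trans hcn).trans hh
      nlinarith [norm_nonneg (c k)]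
    show |vecPart (chartSU2 (c k)) b| ≤ ‖h‖
    rw [vecPart_chartSU2 hc1]
    exact ((abs_apply_le_norm (c k) b).trans (norm_le_pi_norm c k)).trans hcn
  -- per link (the mean drops out)
  have hlin : ∀ e : Edge 3 L, ‖(fun a => relLinkVec L (gaugeTransform (fun x => chartSU2 (ξ x)) (orthoTube L u w)) (e, a)) -
      (w e - covGrad L u (fun x => ξ x - siteMean L ξ) e)‖ ≤ 2772 * ‖h‖ ^ 2 := fun e => by
    have h1 := norm_relLinkVec_gaugeTransform_orthoTube_sub_le' (u := u) hG hω hh (by linarith) (by linarith : ‖h‖ ≤ 1) hcτ hbal e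
    calc _ ≤ 11 * (40 * (4 * ‖h‖ ^ 2 + 2 * ‖h‖ * ‖h‖) + 12 * ‖h‖ * ‖h‖) := h1
      _ = 2772 * ‖h‖ ^ 2 := by ring
  -- covariant vs vacuum gradient on `ξ − ξ̄`
  have hη : ∀ y, ‖ξ y - siteMean L ξ‖ ≤ 2 * ‖h‖ := fun y => by
    calc ‖ξ y - siteMean L ξ‖ ≤ ‖ξ y‖ + ‖siteMean L ξ‖ := norm_sub_le _ _
      _ ≤ ‖h‖ + ‖h‖ := add_le_add (hG y) (norm_siteMean_le L hG)
      _ = 2 * ‖h‖ := by ring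
  have hcov : ∀ (e : Edge 3 L) (a : Fin 3),
      |(covGrad L u (fun x => ξ x - siteMean L ξ) e - ((ξ (e.1.shift e.2) - siteMean L ξ) - (ξ e.1 - siteMean L ξ))) a| ≤ 24 * ‖h‖ ^ 2 := fun e a => by
    have hform : (covGrad L u (fun x => ξ x - siteMean L ξ) e - ((ξ (e.1.shift e.2) - siteMean L ξ) - (ξ e.1 - siteMean L ξ))) a =
        ((adRot (u (0, e.2)) - 1).mulVec (ξ (e.1.shift e.2) - siteMean L ξ)) a := by
      simp only [covGrad, Pi.sub_apply, Matrix.sub_mulVec, Matrix.one_mulVec]; ring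
    rw [hform]
    calc _ ≤ 12 * ‖h‖ * ‖ξ (e.1.shift e.2) - siteMean L ξ‖ := abs_adRot_sub_one_mulVec_le _ (by linarith) (hcτ e.2) _ a
      _ ≤ 12 * ‖h‖ * (2 * ‖h‖) := mul_le_mul_of_nonneg_left (hη _) (by positivity)
      _ = 24 * ‖h‖ ^ 2 := by ring
  -- componentwise
  have hcomp : ∀ ea : Edge 3 L × Fin 3, |(basedFn L h - basedDeriv L h) ea| ≤ 2796 * ‖h‖ ^ 2 := fun ea => by
    have hval : (basedFn L h - basedDeriv L h) ea =
        ((fun a => relLinkVec L (gaugeTransform (fun x => chartSU2 (ξ x)) (orthoTube L u w)) (ea.1, a)) - (w ea.1 - covGrad L u (fun x => ξ x - siteMean L ξ) ea.1)) ea.2 -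
          (covGrad L u (fun x => ξ x - siteMean L ξ) ea.1 - ((ξ (ea.1.1.shift ea.1.2) - siteMean L ξ) - (ξ ea.1.1 - siteMean L ξ))) ea.2 := by
      rw [WithLp.ofLp_sub, Pi.sub_apply, basedDeriv_apply, WithLp.ofLp_sub, Pi.sub_apply, linkEmbed_apply,
        show ea = (ea.1, ea.2) from rfl, vacGrad_apply]
      simp only [basedFn, actCfg, basedIncl_apply, Pi.sub_apply]
      ring
    rw [hval]
    have h1 : |((fun a => relLinkVec L (gaugeTransform (fun x => chartSU2 (ξ x)) (orthoTube L u w)) (ea.1, a)) -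
        (w ea.1 - covGrad L u (fun x => ξ x - siteMean L ξ) ea.1)) ea.2| ≤ 2772 * ‖h‖ ^ 2 :=
      (abs_apply_le_norm _ ea.2).trans (hlin ea.1)
    have h2 := hcov ea.1 ea.2
    calc _ ≤ |((fun a => relLinkVec L (gaugeTransform (fun x => chartSU2 (ξ x)) (orthoTube L u w)) (ea.1, a)) -
          (w ea.1 - covGrad L u (fun x => ξ x - siteMean L ξ) ea.1)) ea.2| +
          |(covGrad L u (fun x => ξ x - siteMean L ξ) ea.1 - ((ξ (ea.1.1.shift ea.1.2) - siteMean L ξ) - (ξ ea.1.1 - siteMean L ξ))) ea.2| := abs_sub _ _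
      _ ≤ 2772 * ‖h‖ ^ 2 + 24 * ‖h‖ ^ 2 := add_le_add h1 h2
      _ = 2796 * ‖h‖ ^ 2 := by ring
  have hsq : ‖basedFn L h - basedDeriv L h‖ ^ 2 ≤ (2796 * Real.sqrt (3 * Fintype.card (Edge 3 L)) * ‖h‖ ^ 2) ^ 2 := by
    rw [EuclideanSpace.norm_sq_eq]
    calc ∑ ea, ‖(basedFn L h - basedDeriv L h) ea‖ ^ 2 ≤ ∑ _ea : Edge 3 L × Fin 3, (2796 * ‖h‖ ^ 2) ^ 2 :=
          Finset.sum_le_sum fun ea _ => by rw [Real.norm_eq_abs]; exact pow_le_pow_left₀ (abs_nonneg _) (hcomp ea) 2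
      _ = (3 * Fintype.card (Edge 3 L)) * (2796 * ‖h‖ ^ 2) ^ 2 := by
          rw [Finset.sum_const, Finset.card_univ, nsmul_eq_mul, Fintype.card_prod, Fintype.card_fin]; push_cast; ring
      _ = (2796 * Real.sqrt (3 * Fintype.card (Edge 3 L)) * ‖h‖ ^ 2) ^ 2 := by
          rw [show (2796 * Real.sqrt (3 * Fintype.card (Edge 3 L)) * ‖h‖ ^ 2) ^ 2 = Real.sqrt (3 * Fintype.card (Edge 3 L)) ^ 2 * (2796 * ‖h‖ ^ 2) ^ 2 by ring,
            Real.sq_sqrt (by positivity)]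
  exact (abs_le_of_sq_le_sq' hsq (by positivity)).2

/-- `fB 0 = 0`. [folklore] -/
theorem basedFn_zero : basedFn L 0 = 0 := by
  simp only [basedFn, map_zero]; exact relLinkVec_actCfg_zero L

/-- ★ The derivative of `fB` at `0` is `(ξ', (w', c')) ↦ w' − ∇ξ'`. [folklore] -/
theorem hasFDerivAt_basedFn : HasFDerivAt (basedFn L) (basedDeriv L) 0 := by
  rw [hasFDerivAt_iff_isLittleO_nhds_zero]
  simp only [basedFn_zero, sub_zero, zero_add]
  refine isLittleO_iff.mpr fun ε hε => ?_
  set M : ℝ := 2796 * Real.sqrt (3 * Fintype.card (Edge 3 L)) with hM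
  have hM0 : 0 < M := by
    rw [hM]; have : (0 : ℝ) < Fintype.card (Edge 3 L) := by exact_mod_cast Fintype.card_pos
    positivity
  have hball : Metric.closedBall (0 : BasedDom L) (min (1 / 40) (ε / M)) ∈ 𝓝 (0 : BasedDom L) :=
    Metric.closedBall_mem_nhds 0 (lt_min (by norm_num) (div_pos hε hM0))
  filter_upwards [hball] with h hh
  rw [Metric.mem_closedBall, dist_zero_right] at hh
  have h1 := norm_basedFn_sub_basedDeriv_le L h (hh.trans (min_le_left _ _))
  have h2 : M * ‖h‖ ≤ ε := by
    have := hh.trans (min_le_right _ _)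
    rwa [le_div_iff₀ hM0, mul_comm] at this
  calc ‖basedFn L h - basedDeriv L h‖ ≤ M * ‖h‖ ^ 2 := h1
    _ = (M * ‖h‖) * ‖h‖ := by ring
    _ ≤ ε * ‖h‖ := mul_le_mul_of_nonneg_right h2 (norm_nonneg _)

/-- `fB` is `C^n` at `0`. [folklore] -/
theorem contDiffAt_basedFn {n : WithTop ℕ∞} : ContDiffAt ℝ n (basedFn L) 0 := by
  have h := contDiffAt_relLinkVec_actCfg L (n := n)
  have h0 : basedIncl L 0 = 0 := map_zero _
  rw [← h0] at h
  exact h.comp 0 (basedIncl L).contDiff.contDiffAt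

/-- ★ `fderiv fB 0 = basedDeriv`. [folklore] -/
theorem fderiv_basedFn_zero : fderiv ℝ (basedFn L) 0 = basedDeriv L := (hasFDerivAt_basedFn L).fderiv

/-! ## §3 The exact linear map at every base point and the uniform remainder -/

/-- The linear map of the Laplace evaluation at base point `p = (w, c)` in based coordinates: `basedLin p = ∂_ξ fB(0, p)`. [folklore] -/
def basedLin (p : balancedSubmodule L × (Fin 3 → Fin 3 → ℝ)) : basedSubmodule L →L[ℝ] LinkSpace L :=
  (fderiv ℝ (basedFn L) (0, p)).comp (ContinuousLinearMap.inl ℝ _ _)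

/-- ★ At the vacuum base point: `basedLin 0 ξ = −∇ξ`. [folklore] -/
theorem basedLin_zero (ξ : basedSubmodule L) : basedLin L 0 ξ = -vacGrad L (ξ : Site 3 L → Fin 3 → ℝ) := by
  rw [basedLin, show ((0 : basedSubmodule L), (0 : balancedSubmodule L × (Fin 3 → Fin 3 → ℝ))) = (0 : BasedDom L) from rfl, fderiv_basedFn_zero,
    ContinuousLinearMap.comp_apply, ContinuousLinearMap.inl_apply, basedDeriv_apply]
  simp

/-- ★★ **UNIFORM SECOND-ORDER EXPANSION IN BASED COORDINATES** with the exact linear map. [folklore] -/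
theorem exists_taylor_two_basedFn : ∃ M ε : ℝ, 0 ≤ M ∧ 0 < ε ∧
    ∀ (ξ : basedSubmodule L) (p : balancedSubmodule L × (Fin 3 → Fin 3 → ℝ)), ‖ξ‖ < ε → ‖p‖ < ε →
      ‖basedFn L (ξ, p) - basedFn L (0, p) - basedLin L p ξ‖ ≤ M * ‖ξ‖ ^ 2 := by
  obtain ⟨M, ε, hM, hε, h⟩ := exists_taylor_two_of_contDiffAt (f := basedFn L) (contDiffAt_basedFn L (n := 2))
  exact ⟨M, ε, hM, hε, fun ξ p hξ hp => h ξ p hξ hp⟩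

/-- The linear map depends continuously on the base point at `0`. [folklore] -/
theorem continuousAt_basedLin : ContinuousAt (fun p : balancedSubmodule L × (Fin 3 → Fin 3 → ℝ) => basedLin L p) 0 := by
  have h1 : ContinuousAt (fderiv ℝ (basedFn L)) ((0 : basedSubmodule L), (0 : balancedSubmodule L × (Fin 3 → Fin 3 → ℝ))) :=
    (contDiffAt_basedFn L (n := 2)).continuousAt_fderiv (by norm_num)
  have h2 : ContinuousAt (fun p : balancedSubmodule L × (Fin 3 → Fin 3 → ℝ) => ((0 : basedSubmodule L), p)) 0 :=
    (continuous_const.prodMk continuous_id).continuousAt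
  have h3 : ContinuousAt (fun p : balancedSubmodule L × (Fin 3 → Fin 3 → ℝ) => fderiv ℝ (basedFn L) (0, p)) 0 := h1.comp h2
  exact ((ContinuousLinearMap.compL ℝ (basedSubmodule L) (BasedDom L) (LinkSpace L)).flip (ContinuousLinearMap.inl ℝ _ _)).continuous.continuousAt.comp h3

/-! ## §4 Coercivity at the vacuum base point -/

/-- ★ Coercivity at the vacuum base point: `‖ξ‖∞ ≤ 2C_L‖P_Γ(basedLin 0 ξ)‖`. [folklore] -/
theorem norm_le_basedLin_zero (ξ : basedSubmodule L) : ‖ξ‖ ≤ 2 * sliceConst L * ‖(gaugeModes L).starProjection (basedLin L 0 ξ)‖ := by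
  have h := norm_le_sliceConst_based L (one_mem_sliceRadius L) (ξ := (ξ : Site 3 L → Fin 3 → ℝ)) ξ.2
  rw [covGradL_one, vacGrad_sub_siteMean] at h
  rw [basedLin_zero, map_neg, norm_neg]
  exact h

end Summit.QuantumFields.YangMills.Theorems.FemtoTransferGap.TwoLattice.ConstTube

end
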